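import Mathlib.Combinatorics.SetFamily.FourFunctions
import Mathlib.Algebra.BigOperators.Ring.Finset
import Mathlib.Data.Fintype.BigOperators
import Mathlib.Data.Real.Basic
import Mathlib.Tactic.Linarith
import HarnessLib

/-!
# The localized (fibrewise) four functions theorem — the RLS inequality

Let `L` be a finite distributive lattice and `a b c d : L → β` nonnegative functions satisfying the
Ahlswede–Daykin hypothesis `a x * b y ≤ c (x ⊔ y) * d (x ⊓ y)`.  The four functions theorem
[cite: AhlswedeDaykin1978, Theorem 1] (Mathlib: `four_functions_theorem`, `four_functions_theorem_univ`)
bounds `(∑ a) * (∑ b) ≤ (∑ c) * (∑ d)` — an inequality between sums over *all* ordered pairs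
`(x, y)`.  This file proves the printed *localization* of that conclusion to every fibre of the map
`(x, y) ↦ (x ⊓ y, x ⊔ y)`:

* `meetJoinFibre u v` — the finset `Ω(u, v) = {(x, y) : x ⊓ y = u ∧ x ⊔ y = v}` of ordered pairs with
  prescribed meet and join (Chan–Pak's `C(u, v)`, [ChanPak2023, §6B p. 239]; `Ω(C, D)` of
  [ChanPak2026, §12.1]); elementary API: symmetry under swapping, uniqueness of the partner
  (relative complements in a distributive lattice are unique), closure of the set of complemented pairs
  under `(x ⊔ y, x' ⊓ y')` and `(x ⊓ y, x' ⊔ y')`, the fibres partition `L × L`.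
* `four_functions_fibre` — the **RLS inequality**: for every `u v`,
  `∑_{(x,y) ∈ Ω(u,v)} a x * b y ≤ ∑_{(x,y) ∈ Ω(u,v)} c x * d y`.
  This is [ChanPak2023, Claim 6.3] (stated and proved there for an arbitrary finite distributive
  lattice, inside the proof of the multivariate AD inequality, Thm 6.1 / Prop 6.2) and
  [ChanPak2026, Thm 12.1 "RLS inequality"] (stated for direct products of chains), where it is attributed
  to Reuter [Reuter1987] (Boolean lattice, the fibre `(∅, X)` = antipodal pairs) and to Lovász–Saks
  [LovaszSaks2006, Thm 8] (Boolean lattice, every fibre): "RLS" = Reuter–Lovász–Saks.  Summing the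
  fibrewise inequality over all `(u, v)` gives back the four functions theorem on `univ × univ`
  (`sum_sum_meetJoinFibre`).
* consequences in the shape in which correlation inequalities are used: `fkg_fibre` (the FKG
  inequality holds fibre by fibre: for a log-supermodular weight `μ ≥ 0` and monotone `f g ≥ 0`,
  `∑_{Ω(u,v)} (μ x f x)(μ y g y) ≤ ∑_{Ω(u,v)} (μ x f x g x) μ y`), its real form without sign conditions on
  `f g` (`fkg_fibre_real`), and the weight-free `sum_meetJoinFibre_mul_le`
  (`∑_{Ω(u,v)} f x * g y ≤ ∑_{Ω(u,v)} f x * g x` for monotone real `f g` on ANY finite distributive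
  lattice).  On a direct product of finite chains with a product weight `w(x) = ∏ᵢ wᵢ(xᵢ)` the monomial
  `w(x) w(y)` in the coordinate weights is determined exactly by `(x ⊓ y, x ⊔ y)`, so the last statement
  says that `Z² · Cov_w(f, g) = Z ∑ w f g − (∑ w f)(∑ w g)` is, monomial by monomial, a polynomial with
  nonnegative coefficients in the weights — the order-two case of coefficientwise positivity.
* `mem_meetJoinFibre_bot_top` / `sum_meetJoinFibre_bot_top` — in a finite Boolean algebra the fibre over
  `(⊥, ⊤)` is the set of antipodal pairs `(x, xᶜ)`; the tree's `four_functions_antipodal`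
  (`AntipodalFourFunctions.lean`, Reuter's case) is thereby the `(⊥, ⊤)` instance of
  `four_functions_fibre` (recorded as an `example`, not re-declared).

Proof of `four_functions_fibre`, as printed [ChanPak2023, pp. 239–240]: only elements `x` having a
(unique) relative complement `xᶜ` in `[u, v]` contribute to `Ω(u, v) = {(x, xᶜ)}`; the four functions
`a' x = a x · b xᶜ`, `b' y = a yᶜ · b y`, `c' x = c x · d xᶜ`, `d' y = c yᶜ · d y` again satisfy the
Ahlswede–Daykin hypothesis because `(x ⊔ y)ᶜ = xᶜ ⊓ yᶜ` and `(x ⊓ y)ᶜ = xᶜ ⊔ yᶜ` (two applications of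
the hypothesis for `(a, b, c, d)`); the usual four functions theorem gives `(∑ a')(∑ b') ≤ (∑ c')(∑ d')`,
while `∑ a' = ∑ b' =` LHS and `∑ c' = ∑ d' =` RHS, whence LHS² ≤ RHS² and LHS ≤ RHS.  Deviation from the
print: instead of restricting "without loss of generality" to the Boolean sublattice of complemented
elements of `[u, v]`, the primed functions are defined on all of `L` as one-term fibre sums
(`rowSum` / `colSum`), which vanish off the complemented elements; Mathlib's `four_functions_theorem_univ`
is then applied on `L` itself.

* `four_functions_graded_univ` / `four_functions_graded` — [ChanPak2023, Prop. 6.2 / Thm 6.1], the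
  MULTIVARIATE (graded) AD inequality of which Claim 6.3 is the key step: for any modular grading
  `κ : L → M` (`κ x + κ y = κ (x ⊔ y) + κ (x ⊓ y)`; the print's `q^{r(x)}`, `r = (r₁, …, r_ℓ)` modular,
  is `M = ℕ^ℓ`) and every degree `e`,
  `∑_{x ∈ X, y ∈ Y, κ x + κ y = e} a x b y ≤ ∑_{z ∈ X ⊻ Y, w ∈ X ⊼ Y, κ z + κ w = e} c z d w`
  (i.e. (6-3) coefficientwise); proof as printed (regroup a degree class by fibres,
  `sum_degree_eq_sum_fibres`, apply the RLS inequality per fibre; cut the four functions off to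
  `X, Y, X ⊻ Y, X ⊼ Y`); `fkg_graded_real` = the FKG consequence per degree class.

What is NOT here: the `q`-polynomial packaging of (6-3) itself (we state it coefficient by coefficient)
and the Lovász–Saks formulation for set functions on `2^X` with its own proof [LovaszSaks2006]
(paywalled; want acq-09160).

## References

* [ChanPak2023] S. H. Chan, I. Pak, *Multivariate correlation inequalities for P-partitions*, Pacific J.
  Math. 323 (2023) 223–252, doi:10.2140/pjm.2023.323.223 — §6B, Claim 6.3 (pp. 239–240).
* [ChanPak2026] S. H. Chan, I. Pak, *Equality conditions for correlation inequalities*, arXiv:2607.06275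
  (2026) — §12.1, Theorem 12.1 (RLS inequality) and the attribution paragraph (p. 36).
* [LovaszSaks2006] L. Lovász, M. Saks, *A localization inequality for set functions*, J. Combin. Theory
  Ser. A 113 (2006) 726–735 — Thm 8.
* [Reuter1987] K. Reuter, *Note on the Ahlswede–Daykin inequality*, Discrete Math. 65 (1987) 209–212.
* [AhlswedeDaykin1978] R. Ahlswede, D. E. Daykin, *An inequality for the weights of two families of
  sets, their unions and intersections*, Z. Wahrsch. Verw. Gebiete 43 (1978) 183–185.
-/

namespace Literature.Combinatorics.SetFamily

open Finset
open scoped FinsetFamily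

variable {α β : Type*}

/-! ## The fibres of `(x, y) ↦ (x ⊓ y, x ⊔ y)` -/

section Fibre

variable [DistribLattice α] [Fintype α] [DecidableEq α]

/-- The fibre `Ω(u, v) = {(x, y) ∈ L × L : x ⊓ y = u, x ⊔ y = v}` of the meet–join map: the ordered pairs
of relative complements in the interval `[u, v]` (empty unless `u ≤ v`; `{(u, u)}` when `u = v`).
This is `C(u, v)` of [cite: ChanPak2023, §6B p. 239] and `Ω(C, D)` (`C = v`, `D = u`) of
[ChanPak2026, Thm 12.1]. -/
def meetJoinFibre (u v : α) : Finset (α × α) :=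
  univ.filter fun p => p.1 ⊓ p.2 = u ∧ p.1 ⊔ p.2 = v

/-- Membership in the fibre `Ω(u, v)`. [cite: ChanPak2023, §6B p. 239] -/
@[simp] theorem mem_meetJoinFibre {u v : α} {p : α × α} :
    p ∈ meetJoinFibre u v ↔ p.1 ⊓ p.2 = u ∧ p.1 ⊔ p.2 = v := by
  simp [meetJoinFibre]

/-- `Ω(u, v)` is symmetric under swapping the pair. [cite: ChanPak2023, §6B p. 239] -/
theorem swap_mem_meetJoinFibre {u v x y : α} :
    (y, x) ∈ meetJoinFibre u v ↔ (x, y) ∈ meetJoinFibre u v := by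
  simp only [mem_meetJoinFibre, inf_comm y x, sup_comm y x]

/-- Both members of a pair in `Ω(u, v)` lie in the interval `[u, v]`.
[cite: ChanPak2023, §6B p. 239] -/
theorem le_of_mem_meetJoinFibre {u v x y : α} (h : (x, y) ∈ meetJoinFibre u v) :
    u ≤ x ∧ x ≤ v ∧ u ≤ y ∧ y ≤ v := by
  rw [mem_meetJoinFibre] at h
  obtain ⟨hu, hv⟩ := h
  exact ⟨hu ▸ inf_le_left, hv ▸ le_sup_left, hu ▸ inf_le_right, hv ▸ le_sup_right⟩

/-- A nonempty fibre has `u ≤ v`. [cite: ChanPak2023, §6B p. 239] -/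
theorem le_of_mem_meetJoinFibre' {u v : α} {p : α × α} (h : p ∈ meetJoinFibre u v) : u ≤ v := by
  obtain ⟨x, y⟩ := p
  have b := le_of_mem_meetJoinFibre h
  exact b.1.trans b.2.1

/-- The fibre over a pair `u ≰ v` is empty. [cite: ChanPak2023, §6B p. 239] -/
theorem meetJoinFibre_eq_empty {u v : α} (h : ¬ u ≤ v) : meetJoinFibre u v = ∅ :=
  Finset.eq_empty_of_forall_notMem fun _ hp => h (le_of_mem_meetJoinFibre' hp)

/-- The diagonal fibre: `Ω(u, u) = {(u, u)}` (the terms `φ(u, u)` of [cite: ChanPak2023, §6B p. 239]). -/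
@[simp] theorem meetJoinFibre_self (u : α) : meetJoinFibre u u = {(u, u)} := by
  ext ⟨x, y⟩
  simp only [mem_meetJoinFibre, mem_singleton, Prod.mk.injEq]
  constructor
  · rintro ⟨hu, hv⟩
    have hx : x = u := le_antisymm (hv ▸ le_sup_left) (hu ▸ inf_le_left)
    have hy : y = u := le_antisymm (hv ▸ le_sup_right) (hu ▸ inf_le_right)
    exact ⟨hx, hy⟩
  · rintro ⟨rfl, rfl⟩
    exact ⟨inf_idem _, sup_idem _⟩

/-- `(u, v)` itself lies in `Ω(u, v)` whenever `u ≤ v`. [cite: ChanPak2023, §6B p. 239] -/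
theorem mk_mem_meetJoinFibre {u v : α} (h : u ≤ v) : (u, v) ∈ meetJoinFibre u v := by
  simp [h]

/-- **Relative complements in a distributive lattice are unique**: the partner of `x` in `Ω(u, v)` is
determined by `x` ("in a finite distributive lattice every element has at most one complement",
[cite: ChanPak2023, §6B p. 239–240], after Birkhoff, *Lattice Theory*, Thm 10). -/
theorem eq_of_mem_meetJoinFibre {u v x y y' : α} (h : (x, y) ∈ meetJoinFibre u v)
    (h' : (x, y') ∈ meetJoinFibre u v) : y = y' := by
  rw [mem_meetJoinFibre] at h h'
  obtain ⟨hu, hv⟩ := h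
  obtain ⟨hu', hv'⟩ := h'
  dsimp only at hu hv hu' hv'
  have key : ∀ {y y' : α}, x ⊓ y = u → x ⊔ y = v → x ⊓ y' = u → x ⊔ y' = v → y ≤ y' := by
    intro y y' hu hv hu' hv'
    calc y = y ⊓ (x ⊔ y') := by rw [hv', ← hv, sup_comm, inf_sup_self]
      _ = y ⊓ x ⊔ y ⊓ y' := inf_sup_left _ _ _
      _ ≤ y' := sup_le (by rw [inf_comm, hu, ← hu']; exact inf_le_right) inf_le_right
  exact le_antisymm (key hu hv hu' hv') (key hu' hv' hu hv)

/-- Uniqueness in the first coordinate. [cite: ChanPak2023, §6B p. 239–240] -/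
theorem eq_of_mem_meetJoinFibre' {u v x x' y : α} (h : (x, y) ∈ meetJoinFibre u v)
    (h' : (x', y) ∈ meetJoinFibre u v) : x = x' :=
  eq_of_mem_meetJoinFibre (swap_mem_meetJoinFibre.2 h) (swap_mem_meetJoinFibre.2 h')

/-- **De Morgan for relative complements**: if `(x, x'), (y, y') ∈ Ω(u, v)` then
`(x ⊔ y, x' ⊓ y') ∈ Ω(u, v)` — the step `(x ∨ y)ᶜ = xᶜ ∧ yᶜ` of [cite: ChanPak2023, §6B p. 240]. -/
theorem sup_inf_mem_meetJoinFibre {u v x x' y y' : α} (hx : (x, x') ∈ meetJoinFibre u v)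
    (hy : (y, y') ∈ meetJoinFibre u v) : (x ⊔ y, x' ⊓ y') ∈ meetJoinFibre u v := by
  have bx := le_of_mem_meetJoinFibre hx
  have hby := le_of_mem_meetJoinFibre hy
  rw [mem_meetJoinFibre] at hx hy ⊢
  obtain ⟨hxu, hxv⟩ := hx
  obtain ⟨hyu, hyv⟩ := hy
  dsimp only at hxu hxv hyu hyv ⊢
  constructor
  · have e1 : x ⊓ (x' ⊓ y') = u := by
      rw [← inf_assoc, hxu]; exact inf_eq_left.2 hby.2.2.1
    have e2 : y ⊓ (x' ⊓ y') = u := by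
      rw [inf_left_comm, hyu]; exact inf_eq_right.2 bx.2.2.1
    rw [inf_sup_right, e1, e2, sup_idem]
  · have e1 : x ⊔ y ⊔ x' = v := by
      rw [sup_right_comm, hxv]; exact sup_eq_left.2 hby.2.1
    have e2 : x ⊔ y ⊔ y' = v := by
      rw [sup_assoc, hyv]; exact sup_eq_right.2 bx.2.1
    rw [sup_inf_left, e1, e2, inf_idem]

/-- Dually, `(x ⊓ y, x' ⊔ y') ∈ Ω(u, v)` — the step `(x ∧ y)ᶜ = xᶜ ∨ yᶜ` of
[cite: ChanPak2023, §6B p. 240]. -/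
theorem inf_sup_mem_meetJoinFibre {u v x x' y y' : α} (hx : (x, x') ∈ meetJoinFibre u v)
    (hy : (y, y') ∈ meetJoinFibre u v) : (x ⊓ y, x' ⊔ y') ∈ meetJoinFibre u v :=
  swap_mem_meetJoinFibre.1 <|
    sup_inf_mem_meetJoinFibre (swap_mem_meetJoinFibre.2 hx) (swap_mem_meetJoinFibre.2 hy)

/-- The row of `x` in `Ω(u, v)` is the single pair `(x, x')`. [cite: ChanPak2023, §6B p. 239–240] -/
theorem filter_fst_meetJoinFibre {u v x x' : α} (hx : (x, x') ∈ meetJoinFibre u v) :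
    (meetJoinFibre u v).filter (fun p => p.1 = x) = {(x, x')} := by
  ext ⟨p1, p2⟩
  simp only [mem_filter, mem_singleton, Prod.mk.injEq]
  constructor
  · rintro ⟨hp, rfl⟩
    exact ⟨rfl, (eq_of_mem_meetJoinFibre hx hp).symm⟩
  · rintro ⟨rfl, rfl⟩
    exact ⟨hx, rfl⟩

/-- The column of `y` in `Ω(u, v)` is the single pair `(y', y)`. [cite: ChanPak2023, §6B p. 239–240] -/
theorem filter_snd_meetJoinFibre {u v y y' : α} (hy : (y', y) ∈ meetJoinFibre u v) :
    (meetJoinFibre u v).filter (fun p => p.2 = y) = {(y', y)} := by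
  ext ⟨p1, p2⟩
  simp only [mem_filter, mem_singleton, Prod.mk.injEq]
  constructor
  · rintro ⟨hp, rfl⟩
    exact ⟨(eq_of_mem_meetJoinFibre' hy hp).symm, rfl⟩
  · rintro ⟨rfl, rfl⟩
    exact ⟨hy, rfl⟩

/-- The fibres `Ω(u, v)` partition `L × L`: summing a function fibre by fibre gives its total sum (the
regrouping `Φ_d = ∑_{u,v} ψ(u, v) + ∑_u φ(u, u)` of [cite: ChanPak2023, §6B p. 239]). -/
theorem sum_sum_meetJoinFibre {M : Type*} [AddCommMonoid M] (φ : α × α → M) :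
    ∑ u, ∑ v, ∑ p ∈ meetJoinFibre u v, φ p = ∑ p : α × α, φ p := by
  have key := Finset.sum_fiberwise (univ : Finset (α × α)) (fun p : α × α => (p.1 ⊓ p.2, p.1 ⊔ p.2)) φ
  rw [Fintype.sum_prod_type] at key
  rw [← key]
  refine Finset.sum_congr rfl fun u _ => Finset.sum_congr rfl fun v _ => ?_
  refine Finset.sum_congr ?_ fun _ _ => rfl
  ext p
  simp only [mem_meetJoinFibre, mem_filter, mem_univ, true_and, Prod.mk.injEq]

/-- Swapping the summation pair inside a fibre. [cite: ChanPak2023, §6B p. 239] -/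
theorem sum_meetJoinFibre_swap {M : Type*} [AddCommMonoid M] (φ : α → α → M) (u v : α) :
    ∑ p ∈ meetJoinFibre u v, φ p.1 p.2 = ∑ p ∈ meetJoinFibre u v, φ p.2 p.1 := by
  refine Finset.sum_nbij' Prod.swap Prod.swap ?_ ?_ ?_ ?_ ?_
  · rintro ⟨x, y⟩ h; exact swap_mem_meetJoinFibre.2 h
  · rintro ⟨x, y⟩ h; exact swap_mem_meetJoinFibre.2 h
  · rintro ⟨x, y⟩ _; rfl
  · rintro ⟨x, y⟩ _; rfl
  · rintro ⟨x, y⟩ _; rfl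

end Fibre

/-! ## One-term row and column sums over a fibre -/

section RowCol

variable [DecidableEq α] [AddCommMonoid β]

/-- Row sum of `φ` over a finset of pairs: `∑_{p ∈ F, p.1 = x} φ p` (over a fibre `Ω(u, v)`: the single
term `φ (x, xᶜ)` if `x` is complemented in `[u, v]`, else `0` — the functions `α', γ'` of
[cite: ChanPak2023, §6B p. 240]). -/
def rowSum (F : Finset (α × α)) (φ : α × α → β) (x : α) : β := ∑ p ∈ F with p.1 = x, φ p

/-- Column sum of `φ`: `∑_{p ∈ F, p.2 = y} φ p` (the functions `β', δ'` of
[cite: ChanPak2023, §6B p. 240]). -/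
def colSum (F : Finset (α × α)) (φ : α × α → β) (y : α) : β := ∑ p ∈ F with p.2 = y, φ p

/-- The row sum vanishes at an element with no partner. [cite: ChanPak2023, §6B p. 240] -/
theorem rowSum_eq_zero {F : Finset (α × α)} (φ : α × α → β) {x : α} (hx : ¬ ∃ x', (x, x') ∈ F) :
    rowSum F φ x = 0 := by
  refine Finset.sum_eq_zero fun p hp => ?_
  rw [mem_filter] at hp
  exact absurd ⟨p.2, by simpa [← hp.2] using hp.1⟩ hx

/-- The column sum vanishes at an element with no partner. [cite: ChanPak2023, §6B p. 240] -/
theorem colSum_eq_zero {F : Finset (α × α)} (φ : α × α → β) {y : α} (hy : ¬ ∃ y', (y', y) ∈ F) :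
    colSum F φ y = 0 := by
  refine Finset.sum_eq_zero fun p hp => ?_
  rw [mem_filter] at hp
  exact absurd ⟨p.1, by simpa [← hp.2] using hp.1⟩ hy

variable [Fintype α]

/-- `∑_x rowSum F φ x = ∑_{p ∈ F} φ p`. [cite: ChanPak2023, §6B p. 240] -/
theorem sum_rowSum (F : Finset (α × α)) (φ : α × α → β) : ∑ x, rowSum F φ x = ∑ p ∈ F, φ p :=
  Finset.sum_fiberwise F Prod.fst φ

/-- `∑_y colSum F φ y = ∑_{p ∈ F} φ p`. [cite: ChanPak2023, §6B p. 240] -/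
theorem sum_colSum (F : Finset (α × α)) (φ : α × α → β) : ∑ y, colSum F φ y = ∑ p ∈ F, φ p :=
  Finset.sum_fiberwise F Prod.snd φ

variable [DistribLattice α]

/-- Over a fibre, the row sum at a complemented `x` is the single term `φ (x, x')`.
[cite: ChanPak2023, §6B p. 240] -/
theorem rowSum_meetJoinFibre {u v x x' : α} (φ : α × α → β) (hx : (x, x') ∈ meetJoinFibre u v) :
    rowSum (meetJoinFibre u v) φ x = φ (x, x') := by
  rw [rowSum, filter_fst_meetJoinFibre hx, sum_singleton]

/-- Over a fibre, the column sum at a complemented `y` is the single term `φ (y', y)`.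
[cite: ChanPak2023, §6B p. 240] -/
theorem colSum_meetJoinFibre {u v y y' : α} (φ : α × α → β) (hy : (y', y) ∈ meetJoinFibre u v) :
    colSum (meetJoinFibre u v) φ y = φ (y', y) := by
  rw [colSum, filter_snd_meetJoinFibre hy, sum_singleton]

end RowCol

/-! ## The RLS inequality -/

section RLS

variable [DistribLattice α] [Fintype α] [DecidableEq α]
  [CommSemiring β] [LinearOrder β] [IsStrictOrderedRing β] [ExistsAddOfLE β]

/-- **The RLS inequality (localized four functions theorem)** — Reuter 1987 / Lovász–Saks 2006 /
Chan–Pak 2023.  Let `L` be a finite distributive lattice and `a b c d : L → β` nonnegative with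
`a x * b y ≤ c (x ⊔ y) * d (x ⊓ y)` for all `x y` (the Ahlswede–Daykin hypothesis).  Then for every
`u v ∈ L`, summing over the pairs `(x, y)` with `x ⊓ y = u`, `x ⊔ y = v`,
`∑_{Ω(u,v)} a x * b y ≤ ∑_{Ω(u,v)} c x * d y`.
As printed: [cite: ChanPak2023, Claim 6.3 (§6B, pp. 239–240)] ("for every `u, v ∈ L` such that
`u ≺ v`, we have `ψ(u, v) ≤ 0`", `ψ(u,v) = ∑_{C(u,v)} α(x)β(y) − γ(x)δ(y)`; any finite distributive
lattice); = [ChanPak2026, Thm 12.1 "RLS inequality"] (`L` a product of `M`-chains: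
"`∑_{(A,B)∈Ω(C,D)} a(A) b(B) ≤ ∑_{(A,B)∈Ω(C,D)} c(A) d(B)`", "proved by the authors in [CP23a, Claim 6.3].
For the Boolean lattice (the case `M = 2`), the result was proved by Lovász–Saks [LS06, Thm 8],
generalizing the case `C = L` and `D = ∅` by Reuter [Reu87]").  The printed proof is followed (see the
module docstring for the one deviation). -/
theorem four_functions_fibre (a b c d : α → β) (ha : 0 ≤ a) (hb : 0 ≤ b) (hc : 0 ≤ c) (hd : 0 ≤ d)
    (h : ∀ x y, a x * b y ≤ c (x ⊔ y) * d (x ⊓ y)) (u v : α) :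
    ∑ p ∈ meetJoinFibre u v, a p.1 * b p.2 ≤ ∑ p ∈ meetJoinFibre u v, c p.1 * d p.2 := by
  set F := meetJoinFibre u v with hF
  -- the primed functions of [ChanPak2023, p. 240], extended by zero off the complemented elements
  let ab : α × α → β := fun p => a p.1 * b p.2
  let cd : α × α → β := fun p => c p.1 * d p.2
  have hab : ∀ p, 0 ≤ ab p := fun p => mul_nonneg (ha _) (hb _)
  have hcd : ∀ p, 0 ≤ cd p := fun p => mul_nonneg (hc _) (hd _)
  let a' : α → β := rowSum F ab
  let b' : α → β := colSum F ab
  let c' : α → β := rowSum F cd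
  let d' : α → β := colSum F cd
  have ha' : 0 ≤ a' := fun x => Finset.sum_nonneg fun p _ => hab p
  have hb' : 0 ≤ b' := fun y => Finset.sum_nonneg fun p _ => hab p
  have hc' : 0 ≤ c' := fun x => Finset.sum_nonneg fun p _ => hcd p
  have hd' : 0 ≤ d' := fun y => Finset.sum_nonneg fun p _ => hcd p
  -- the Ahlswede–Daykin hypothesis for `(a', b', d', c')` (Mathlib puts the meet function third)
  have hyp : ∀ x y, a' x * b' y ≤ d' (x ⊓ y) * c' (x ⊔ y) := by
    intro x y
    by_cases hx : ∃ x', (x, x') ∈ F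
    · by_cases hy : ∃ y', (y', y) ∈ F
      · obtain ⟨x', hxx⟩ := hx
        obtain ⟨y', hyy⟩ := hy
        have hyy' : (y, y') ∈ F := swap_mem_meetJoinFibre.1 hyy
        -- the partners of `x ⊔ y` and `x ⊓ y`
        have m1 : (x ⊔ y, x' ⊓ y') ∈ F := sup_inf_mem_meetJoinFibre hxx hyy'
        have m2 : (x' ⊔ y', x ⊓ y) ∈ F :=
          swap_mem_meetJoinFibre.2 (inf_sup_mem_meetJoinFibre hxx hyy')
        have e1 : a' x = a x * b x' := rowSum_meetJoinFibre ab hxx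
        have e2 : b' y = a y' * b y := colSum_meetJoinFibre ab hyy
        have e3 : c' (x ⊔ y) = c (x ⊔ y) * d (x' ⊓ y') := rowSum_meetJoinFibre cd m1
        have e4 : d' (x ⊓ y) = c (x' ⊔ y') * d (x ⊓ y) := colSum_meetJoinFibre cd m2
        rw [e1, e2, e3, e4]
        have i1 := h x y
        have i2 := h y' x'
        rw [sup_comm y' x', inf_comm y' x'] at i2
        have n1 : 0 ≤ a x * b y := mul_nonneg (ha _) (hb _)
        have n2 : 0 ≤ a y' * b x' := mul_nonneg (ha _) (hb _)
        calc a x * b x' * (a y' * b y)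
            = (a x * b y) * (a y' * b x') := by ring
          _ ≤ (c (x ⊔ y) * d (x ⊓ y)) * (c (x' ⊔ y') * d (x' ⊓ y')) :=
              mul_le_mul i1 i2 n2 (mul_nonneg (hc _) (hd _))
          _ = c (x' ⊔ y') * d (x ⊓ y) * (c (x ⊔ y) * d (x' ⊓ y')) := by ring
      · have e2 : b' y = 0 := colSum_eq_zero ab hy
        rw [e2, mul_zero]
        exact mul_nonneg (hd' _) (hc' _)
    · have e1 : a' x = 0 := rowSum_eq_zero ab hx
      rw [e1, zero_mul]
      exact mul_nonneg (hd' _) (hc' _)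
  have ad := four_functions_theorem_univ a' b' d' c' ha' hb' hd' hc' hyp
  -- identify the four sums
  have sa : ∑ x, a' x = ∑ p ∈ F, ab p := sum_rowSum F ab
  have sb : ∑ y, b' y = ∑ p ∈ F, ab p := sum_colSum F ab
  have sc : ∑ x, c' x = ∑ p ∈ F, cd p := sum_rowSum F cd
  have sd : ∑ y, d' y = ∑ p ∈ F, cd p := sum_colSum F cd
  rw [sa, sb, sc, sd] at ad
  have h0 : 0 ≤ ∑ p ∈ F, cd p := Finset.sum_nonneg fun p _ => hcd p
  -- `S² ≤ T²` with `T ≥ 0` forces `S ≤ T`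
  rcases le_or_gt (∑ p ∈ F, ab p) (∑ p ∈ F, cd p) with hle | hlt
  · exact hle
  · exact absurd ad (not_le.mpr (mul_self_lt_mul_self h0 hlt))

/-- **Daykin's inequality, fibrewise**: for finsets `s t` of a finite distributive lattice and every
`u v`, `#{(x, y) ∈ Ω(u,v) : x ∈ s, y ∈ t} ≤ #{(x, y) ∈ Ω(u,v) : x ∈ s ⊻ t, y ∈ s ⊼ t}` — the case
`a = 𝟙_s, b = 𝟙_t, c = 𝟙_{s ⊻ t}, d = 𝟙_{s ⊼ t}` of `four_functions_fibre`
([cite: ChanPak2023, Claim 6.3]; summed over the fibres it is Mathlib's `Finset.le_card_infs_mul_card_sups`). -/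
theorem card_meetJoinFibre_filter_le (s t : Finset α) (u v : α) :
    #{p ∈ meetJoinFibre u v | p.1 ∈ s ∧ p.2 ∈ t}
      ≤ #{p ∈ meetJoinFibre u v | p.1 ∈ s ⊻ t ∧ p.2 ∈ s ⊼ t} := by
  have key := four_functions_fibre (β := ℕ)
    (fun x => if x ∈ s then 1 else 0) (fun y => if y ∈ t then 1 else 0)
    (fun x => if x ∈ s ⊻ t then 1 else 0) (fun y => if y ∈ s ⊼ t then 1 else 0)
    (fun _ => by positivity) (fun _ => by positivity) (fun _ => by positivity)
    (fun _ => by positivity) ?_ u v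
  · calc #{p ∈ meetJoinFibre u v | p.1 ∈ s ∧ p.2 ∈ t}
          = ∑ p ∈ meetJoinFibre u v, (if p.1 ∈ s then 1 else 0) * (if p.2 ∈ t then 1 else 0) := by
            rw [Finset.card_filter]
            refine Finset.sum_congr rfl fun p _ => ?_
            by_cases h1 : p.1 ∈ s <;> by_cases h2 : p.2 ∈ t <;> simp [h1, h2]
      _ ≤ ∑ p ∈ meetJoinFibre u v,
            (if p.1 ∈ s ⊻ t then 1 else 0) * (if p.2 ∈ s ⊼ t then 1 else 0) := key
      _ = #{p ∈ meetJoinFibre u v | p.1 ∈ s ⊻ t ∧ p.2 ∈ s ⊼ t} := by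
            rw [Finset.card_filter]
            refine Finset.sum_congr rfl fun p _ => ?_
            by_cases h1 : p.1 ∈ s ⊻ t <;> by_cases h2 : p.2 ∈ s ⊼ t <;> simp [h1, h2]
  · intro x y
    by_cases hx : x ∈ s
    · by_cases hy : y ∈ t
      · have h1 : x ⊔ y ∈ s ⊻ t := sup_mem_sups hx hy
        have h2 : x ⊓ y ∈ s ⊼ t := inf_mem_infs hx hy
        simp [hx, hy, h1, h2]
      · simp [hy]
    · simp [hx]

/-- **FKG, fibre by fibre** (nonnegative form): for a log-supermodular weight `μ ≥ 0`
(`μ x μ y ≤ μ (x ⊓ y) μ (x ⊔ y)`) and monotone `f g ≥ 0` on a finite distributive lattice, every fibre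
`Ω(u, v)` of the meet–join map satisfies
`∑_{Ω(u,v)} (μ x f x) (μ y g y) ≤ ∑_{Ω(u,v)} (μ x f x g x) μ y`.
The case `a = μ f, b = μ g, c = μ f g, d = μ` of the RLS inequality [cite: ChanPak2023, Claim 6.3];
summed over all fibres it is the FKG inequality [FortuinKasteleynGinibre1971] (Mathlib `fkg`). -/
theorem fkg_fibre (μ f g : α → β) (hμ₀ : 0 ≤ μ) (hf₀ : 0 ≤ f) (hg₀ : 0 ≤ g) (hf : Monotone f)
    (hg : Monotone g) (hμ : ∀ x y, μ x * μ y ≤ μ (x ⊓ y) * μ (x ⊔ y)) (u v : α) :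
    ∑ p ∈ meetJoinFibre u v, μ p.1 * f p.1 * (μ p.2 * g p.2)
      ≤ ∑ p ∈ meetJoinFibre u v, μ p.1 * (f p.1 * g p.1) * μ p.2 := by
  refine four_functions_fibre (fun x => μ x * f x) (fun y => μ y * g y)
    (fun x => μ x * (f x * g x)) μ (fun x => mul_nonneg (hμ₀ x) (hf₀ x))
    (fun y => mul_nonneg (hμ₀ y) (hg₀ y))
    (fun x => mul_nonneg (hμ₀ x) (mul_nonneg (hf₀ x) (hg₀ x))) hμ₀ (fun x y => ?_) u v
  calc μ x * f x * (μ y * g y) = (μ x * μ y) * (f x * g y) := by ring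
    _ ≤ (μ (x ⊓ y) * μ (x ⊔ y)) * (f (x ⊔ y) * g (x ⊔ y)) :=
        mul_le_mul (hμ x y) (mul_le_mul (hf le_sup_left) (hg le_sup_right) (hg₀ _) (hf₀ _))
          (mul_nonneg (hf₀ _) (hg₀ _)) (mul_nonneg (hμ₀ _) (hμ₀ _))
    _ = μ (x ⊔ y) * (f (x ⊔ y) * g (x ⊔ y)) * μ (x ⊓ y) := by ring

end RLS

/-! ## Real forms without sign conditions on `f, g` -/

section Real

variable [DistribLattice α] [Fintype α] [DecidableEq α]

/-- **FKG, fibre by fibre** (real form): for a log-supermodular weight `μ ≥ 0` and monotone real `f g`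
(any signs) on a finite distributive lattice, every fibre `Ω(u, v)` satisfies
`∑_{Ω(u,v)} μ x μ y f x (g y − g x) ≤ 0`, i.e.
`∑_{Ω(u,v)} μ x μ y f x g y ≤ ∑_{Ω(u,v)} μ x μ y f x g x`.
From `fkg_fibre` for `f + s, g + t ≥ 0` by cancelling the cross terms with the swap symmetry of
`Ω(u, v)` (a consequence of [cite: ChanPak2023, Claim 6.3], derived in this file). -/
theorem fkg_fibre_real (μ f g : α → ℝ) (hμ₀ : 0 ≤ μ) (hf : Monotone f) (hg : Monotone g)
    (hμ : ∀ x y, μ x * μ y ≤ μ (x ⊓ y) * μ (x ⊔ y)) (u v : α) :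
    ∑ p ∈ meetJoinFibre u v, μ p.1 * μ p.2 * (f p.1 * g p.2)
      ≤ ∑ p ∈ meetJoinFibre u v, μ p.1 * μ p.2 * (f p.1 * g p.1) := by
  set F := meetJoinFibre u v with hF
  -- nonnegative shifts
  set s : ℝ := ∑ x, |f x| with hs
  set t : ℝ := ∑ x, |g x| with ht
  have hfs : ∀ x, 0 ≤ f x + s := fun x => by
    have h1 : |f x| ≤ s := Finset.single_le_sum (f := fun x => |f x|) (fun y _ => abs_nonneg (f y))
      (mem_univ x)
    have h2 : -|f x| ≤ f x := neg_abs_le (f x)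
    linarith
  have hgt : ∀ x, 0 ≤ g x + t := fun x => by
    have h1 : |g x| ≤ t := Finset.single_le_sum (f := fun x => |g x|) (fun y _ => abs_nonneg (g y))
      (mem_univ x)
    have h2 : -|g x| ≤ g x := neg_abs_le (g x)
    linarith
  have key : ∑ p ∈ F, μ p.1 * (f p.1 + s) * (μ p.2 * (g p.2 + t))
      ≤ ∑ p ∈ F, μ p.1 * ((f p.1 + s) * (g p.1 + t)) * μ p.2 :=
    fkg_fibre μ (fun x => f x + s) (fun x => g x + t) hμ₀ hfs hgt (hf.add_const s)
      (hg.add_const t) hμ u v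
  -- expand both sides
  have eL : ∑ p ∈ F, μ p.1 * (f p.1 + s) * (μ p.2 * (g p.2 + t))
      = ∑ p ∈ F, μ p.1 * μ p.2 * (f p.1 * g p.2) + (t * ∑ p ∈ F, μ p.1 * μ p.2 * f p.1
        + s * ∑ p ∈ F, μ p.1 * μ p.2 * g p.2 + s * t * ∑ p ∈ F, μ p.1 * μ p.2) := by
    rw [Finset.mul_sum, Finset.mul_sum, Finset.mul_sum, ← sum_add_distrib, ← sum_add_distrib,
      ← sum_add_distrib]
    exact Finset.sum_congr rfl fun p _ => by ring
  have eR : ∑ p ∈ F, μ p.1 * ((f p.1 + s) * (g p.1 + t)) * μ p.2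
      = ∑ p ∈ F, μ p.1 * μ p.2 * (f p.1 * g p.1) + (t * ∑ p ∈ F, μ p.1 * μ p.2 * f p.1
        + s * ∑ p ∈ F, μ p.1 * μ p.2 * g p.1 + s * t * ∑ p ∈ F, μ p.1 * μ p.2) := by
    rw [Finset.mul_sum, Finset.mul_sum, Finset.mul_sum, ← sum_add_distrib, ← sum_add_distrib,
      ← sum_add_distrib]
    exact Finset.sum_congr rfl fun p _ => by ring
  -- the cross term in `g` is symmetric under the swap
  have sym : ∑ p ∈ F, μ p.1 * μ p.2 * g p.2 = ∑ p ∈ F, μ p.1 * μ p.2 * g p.1 := by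
    rw [hF, sum_meetJoinFibre_swap (fun x y => μ x * μ y * g y) u v]
    exact Finset.sum_congr rfl fun p _ => by show μ p.2 * μ p.1 * g p.1 = _; ring
  rw [eL, eR, sym] at key
  linarith

/-- **Chebyshev/Harris, fibre by fibre, on any finite distributive lattice**: for monotone real `f g`
and every `u v`, `∑_{x ⊓ y = u, x ⊔ y = v} f x * g y ≤ ∑_{x ⊓ y = u, x ⊔ y = v} f x * g x`.
The case `μ ≡ 1` of `fkg_fibre_real`, i.e. of the RLS inequality [cite: ChanPak2023, Claim 6.3] with
`(a, b, c, d) = (f, g, f g, 1)` after a shift.  On a direct product of finite chains this is, monomial by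
monomial, the nonnegativity of the coefficients of `Z² Cov_w(f, g)` as a polynomial in product weights
`w` (the monomial `w(x) w(y)` is indexed by `(x ⊓ y, x ⊔ y)`); on the Boolean lattice and the fibre
`(∅, X)` it is the antipodal Harris–Kleitman inequality `∑_x f x g xᶜ ≤ ∑_x f x g x`. -/
theorem sum_meetJoinFibre_mul_le (f g : α → ℝ) (hf : Monotone f) (hg : Monotone g) (u v : α) :
    ∑ p ∈ meetJoinFibre u v, f p.1 * g p.2 ≤ ∑ p ∈ meetJoinFibre u v, f p.1 * g p.1 := by
  have key := fkg_fibre_real (fun _ => (1 : ℝ)) f g (fun _ => zero_le_one) hf hg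
    (fun _ _ => le_rfl) u v
  simpa using key

/-- Event form (**fibrewise Harris–Kleitman for up-sets**): for up-sets `A B` of a finite distributive
lattice and every `u v`, `#{(x, y) ∈ Ω(u,v) : x ∈ A, y ∈ B} ≤ #{(x, y) ∈ Ω(u,v) : x ∈ A ∩ B}`.
The case `(a, b, c, d) = (𝟙_A, 𝟙_B, 𝟙_{A ∩ B}, 1)` of the RLS inequality [cite: ChanPak2023, Claim 6.3]
(up-sets make `𝟙_A(x) 𝟙_B(y) ≤ 𝟙_{A∩B}(x ⊔ y)` the Ahlswede–Daykin hypothesis); on the Boolean lattice and the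
fibre `(∅, X)` it is the antipodal Harris–Kleitman count `#{x ∈ A : xᶜ ∈ B} ≤ #(A ∩ B)`, and on a product
of chains it is the coefficientwise nonnegativity of `Z² Cov(𝟙_A, 𝟙_B)` in product weights. -/
theorem card_meetJoinFibre_upperSet_le (A B : Finset α) (hA : IsUpperSet (A : Set α))
    (hB : IsUpperSet (B : Set α)) (u v : α) :
    #{p ∈ meetJoinFibre u v | p.1 ∈ A ∧ p.2 ∈ B} ≤ #{p ∈ meetJoinFibre u v | p.1 ∈ A ∧ p.1 ∈ B} := by
  have key := four_functions_fibre (β := ℕ)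
    (fun x => if x ∈ A then 1 else 0) (fun y => if y ∈ B then 1 else 0)
    (fun x => if x ∈ A ∧ x ∈ B then 1 else 0) (fun _ => 1)
    (fun _ => by positivity) (fun _ => by positivity) (fun _ => by positivity)
    (fun _ => by positivity) ?_ u v
  · calc #{p ∈ meetJoinFibre u v | p.1 ∈ A ∧ p.2 ∈ B}
          = ∑ p ∈ meetJoinFibre u v, (if p.1 ∈ A then 1 else 0) * (if p.2 ∈ B then 1 else 0) := by
            rw [Finset.card_filter]
            refine Finset.sum_congr rfl fun p _ => ?_
            by_cases h1 : p.1 ∈ A <;> by_cases h2 : p.2 ∈ B <;> simp [h1, h2]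
      _ ≤ ∑ p ∈ meetJoinFibre u v, (if p.1 ∈ A ∧ p.1 ∈ B then 1 else 0) * 1 := key
      _ = #{p ∈ meetJoinFibre u v | p.1 ∈ A ∧ p.1 ∈ B} := by
            rw [Finset.card_filter]
            exact Finset.sum_congr rfl fun p _ => by rw [mul_one]
  · intro x y
    by_cases hx : x ∈ A
    · by_cases hy : y ∈ B
      · have h1 : x ⊔ y ∈ A := hA le_sup_left hx
        have h2 : x ⊔ y ∈ B := hB le_sup_right hy
        simp [hx, hy, h1, h2]
      · simp [hy]
    · simp [hx]

end Real

/-! ## The Boolean case: the fibre `(⊥, ⊤)` is the set of antipodal pairs (Reuter's case) -/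

section Boolean

variable [BooleanAlgebra α] [Fintype α] [DecidableEq α]

/-- In a Boolean algebra the fibre over `(⊥, ⊤)` consists of the antipodal pairs `(x, xᶜ)`
([ChanPak2026, §12.1]: Reuter's case "`C = L`, `D = ∅`" [cite: Reuter1987, Theorem]). -/
theorem mem_meetJoinFibre_bot_top {x y : α} : (x, y) ∈ meetJoinFibre (⊥ : α) ⊤ ↔ y = xᶜ := by
  rw [eq_compl_iff_isCompl, isCompl_iff, disjoint_iff, codisjoint_iff, mem_meetJoinFibre,
    inf_comm y x, sup_comm y x]

/-- Sums over the fibre `(⊥, ⊤)` of a finite Boolean algebra are sums over antipodal pairs.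
[cite: Reuter1987, Theorem] (via [ChanPak2026, §12.1]) -/
theorem sum_meetJoinFibre_bot_top {M : Type*} [AddCommMonoid M] (φ : α → α → M) :
    ∑ p ∈ meetJoinFibre (⊥ : α) ⊤, φ p.1 p.2 = ∑ x, φ x xᶜ := by
  have e : meetJoinFibre (⊥ : α) ⊤ = (univ : Finset α).map ⟨fun x => (x, xᶜ), fun x y h => by
      simpa using congrArg Prod.fst h⟩ := by
    ext ⟨x, y⟩
    simp only [mem_meetJoinFibre_bot_top, mem_map, mem_univ, true_and, Function.Embedding.coeFn_mk,
      Prod.mk.injEq]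
    constructor
    · rintro rfl; exact ⟨x, rfl, rfl⟩
    · rintro ⟨z, rfl, rfl⟩; rfl
  rw [e, sum_map]
  rfl

/-- Consistency check: Reuter's antipodal inequality (the tree's `four_functions_antipodal`, file
`AntipodalFourFunctions.lean`, with Mathlib's placement of the meet function third) is the `(⊥, ⊤)`
fibre of `four_functions_fibre`. -/
example {β : Type*} [CommSemiring β] [LinearOrder β] [IsStrictOrderedRing β] [ExistsAddOfLE β]
    (f₁ f₂ f₃ f₄ : α → β) (h₁ : 0 ≤ f₁) (h₂ : 0 ≤ f₂) (h₃ : 0 ≤ f₃) (h₄ : 0 ≤ f₄)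
    (h : ∀ a b, f₁ a * f₂ b ≤ f₃ (a ⊓ b) * f₄ (a ⊔ b)) :
    ∑ a, f₁ a * f₂ aᶜ ≤ ∑ a, f₃ a * f₄ aᶜ := by
  have key : ∑ x, f₁ x * f₂ xᶜ ≤ ∑ x, f₄ x * f₃ xᶜ := by
    have := four_functions_fibre f₁ f₂ f₄ f₃ h₁ h₂ h₄ h₃
      (fun x y => by rw [mul_comm (f₄ _)]; exact h x y) ⊥ ⊤
    rwa [sum_meetJoinFibre_bot_top (fun x y => f₁ x * f₂ y),
      sum_meetJoinFibre_bot_top (fun x y => f₄ x * f₃ y)] at this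
  -- reindex the right-hand side along the involution `ᶜ`
  have e : ∑ x, f₄ x * f₃ xᶜ = ∑ a, f₃ a * f₄ aᶜ :=
    Fintype.sum_equiv (Function.Involutive.toPerm compl compl_involutive) _ _
      (fun x => by show f₄ x * f₃ xᶜ = f₃ xᶜ * f₄ xᶜᶜ; rw [compl_compl, mul_comm])
  exact key.trans_eq e

end Boolean

/-! ## The graded (multivariate) Ahlswede–Daykin inequality of Chan–Pak -/

section Graded

variable [DistribLattice α] [Fintype α] [DecidableEq α]
  [CommSemiring β] [LinearOrder β] [IsStrictOrderedRing β] [ExistsAddOfLE β]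
  {M : Type*} [AddCommMonoid M] [DecidableEq M]

/-- Regrouping a degree class of `L × L` by the fibres of the meet–join map: for a *modular*
grading `κ` (`κ x + κ y = κ (x ⊔ y) + κ (x ⊓ y)`), the degree `κ x + κ y` is constant on each fibre
`Ω(u, v)` (equal to `κ v + κ u`), so a sum over the degree class `{(x, y) : κ x + κ y = e}` is the sum
over the fibres `Ω(u, v)` with `κ v + κ u = e` — the regrouping
`Φ_d = ∑_{r(u)+r(v)=d} ψ(u, v) + …` of [cite: ChanPak2023, §6B p. 239 (proof of Prop. 6.2)]. -/
theorem sum_degree_eq_sum_fibres {N : Type*} [AddCommMonoid N] (κ : α → M)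
    (hκ : ∀ x y, κ x + κ y = κ (x ⊔ y) + κ (x ⊓ y)) (φ : α × α → N) (e : M) :
    ∑ p ∈ (univ : Finset (α × α)).filter (fun p => κ p.1 + κ p.2 = e), φ p
      = ∑ u, ∑ v, if κ v + κ u = e then ∑ p ∈ meetJoinFibre u v, φ p else 0 := by
  rw [Finset.sum_filter, ← sum_sum_meetJoinFibre]
  refine Finset.sum_congr rfl fun u _ => Finset.sum_congr rfl fun v _ => ?_
  rw [← Finset.sum_filter, Finset.filter_congr_decidable]
  by_cases huv : κ v + κ u = e
  · rw [if_pos huv]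
    refine Finset.sum_congr ?_ fun _ _ => rfl
    ext p
    simp only [mem_filter, and_iff_left_iff_imp]
    intro hp
    rw [mem_meetJoinFibre] at hp
    rw [hκ, hp.2, hp.1]
    exact huv
  · rw [if_neg huv]
    refine Finset.sum_eq_zero fun p hp => ?_
    exfalso
    rw [mem_filter, mem_meetJoinFibre] at hp
    apply huv
    rw [← hp.2, ← hp.1.2, ← hp.1.1, ← hκ]

/-- **The graded (multivariate) Ahlswede–Daykin inequality on `L × L`** ([cite: ChanPak2023, Prop. 6.2]
with the monomial `q^{r(x)}` replaced by an abstract modular grading `κ`): for nonnegative `a b c d`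
with `a x * b y ≤ c (x ⊔ y) * d (x ⊓ y)` and every degree `e`,
`∑_{κ x + κ y = e} a x b y ≤ ∑_{κ x + κ y = e} c x d y` (sums over all of `L × L`).  Proof as
printed: regroup both degree classes by fibres (`sum_degree_eq_sum_fibres`) and apply the RLS
inequality `four_functions_fibre` fibre by fibre. -/
theorem four_functions_graded_univ (κ : α → M) (hκ : ∀ x y, κ x + κ y = κ (x ⊔ y) + κ (x ⊓ y))
    (a b c d : α → β) (ha : 0 ≤ a) (hb : 0 ≤ b) (hc : 0 ≤ c) (hd : 0 ≤ d)
    (h : ∀ x y, a x * b y ≤ c (x ⊔ y) * d (x ⊓ y)) (e : M) :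
    ∑ p ∈ (univ : Finset (α × α)).filter (fun p => κ p.1 + κ p.2 = e), a p.1 * b p.2
      ≤ ∑ p ∈ (univ : Finset (α × α)).filter (fun p => κ p.1 + κ p.2 = e), c p.1 * d p.2 := by
  rw [sum_degree_eq_sum_fibres κ hκ _ e, sum_degree_eq_sum_fibres κ hκ _ e]
  refine Finset.sum_le_sum fun u _ => Finset.sum_le_sum fun v _ => ?_
  split_ifs
  · exact four_functions_fibre a b c d ha hb hc hd h u v
  · exact le_rfl

/-- **The multivariate Ahlswede–Daykin inequality** [cite: ChanPak2023, Thm 6.1] (coefficientwise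
form; the monomials `q^{r(x)} = q₁^{r₁(x)} ⋯ q_ℓ^{r_ℓ(x)}` of the print, `r_i` modular, are replaced by
an abstract modular grading `κ : L → M` into an additive commutative monoid, `κ x + κ y = κ (x ⊔ y) +
κ (x ⊓ y)`, which for `M = ℕ^ℓ`, `κ = r` is exactly the printed setting).  As printed: "Let
`L = (L, ∧, ∨)` be a finite distributive lattice, and let `α, β, γ, δ : L → ℝ₊` be nonnegative
functions on `L`. Suppose we have `α(x) · β(y) ≤ γ(x ∨ y) · δ(x ∧ y)` for every `x, y ∈ L` (6-2).
Then `α⟨q,r⟩(X) · β⟨q,r⟩(Y) ⩽_q γ⟨q,r⟩(X ∨ Y) · δ⟨q,r⟩(X ∧ Y)` for every `X, Y ⊆ L` (6-3)", where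
`ρ⟨q,r⟩(X) := ∑_{x ∈ X} ρ(x) q^{r(x)}` (6-1) and `⩽_q` is the coefficientwise order; i.e. for every
degree `e`: `∑_{x ∈ X, y ∈ Y, κ x + κ y = e} a x b y ≤ ∑_{z ∈ X ∨ Y, w ∈ X ∧ Y, κ z + κ w = e} c z d w`.
Proof as printed ("Proposition 6.2 ⇒ Theorem 6.1", p. 238): apply `four_functions_graded_univ` to
`a 𝟙_X, b 𝟙_Y, c 𝟙_{X ∨ Y}, d 𝟙_{X ∧ Y}`. -/
theorem four_functions_graded (κ : α → M) (hκ : ∀ x y, κ x + κ y = κ (x ⊔ y) + κ (x ⊓ y))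
    (a b c d : α → β) (ha : 0 ≤ a) (hb : 0 ≤ b) (hc : 0 ≤ c) (hd : 0 ≤ d)
    (h : ∀ x y, a x * b y ≤ c (x ⊔ y) * d (x ⊓ y)) (s t : Finset α) (e : M) :
    ∑ p ∈ (s ×ˢ t).filter (fun p => κ p.1 + κ p.2 = e), a p.1 * b p.2
      ≤ ∑ p ∈ ((s ⊻ t) ×ˢ (s ⊼ t)).filter (fun p => κ p.1 + κ p.2 = e), c p.1 * d p.2 := by
  -- the four functions cut off to `s, t, s ⊻ t, s ⊼ t`
  set a' : α → β := fun x => if x ∈ s then a x else 0 with ha'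
  set b' : α → β := fun y => if y ∈ t then b y else 0 with hb'
  set c' : α → β := fun x => if x ∈ s ⊻ t then c x else 0 with hc'
  set d' : α → β := fun y => if y ∈ s ⊼ t then d y else 0 with hd'
  have ha'0 : 0 ≤ a' := fun x => by simp only [ha']; split_ifs; exacts [ha x, le_rfl]
  have hb'0 : 0 ≤ b' := fun y => by simp only [hb']; split_ifs; exacts [hb y, le_rfl]
  have hc'0 : 0 ≤ c' := fun x => by simp only [hc']; split_ifs; exacts [hc x, le_rfl]
  have hd'0 : 0 ≤ d' := fun y => by simp only [hd']; split_ifs; exacts [hd y, le_rfl]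
  have h' : ∀ x y, a' x * b' y ≤ c' (x ⊔ y) * d' (x ⊓ y) := by
    intro x y
    simp only [ha', hb', hc', hd']
    by_cases hx : x ∈ s
    · by_cases hy : y ∈ t
      · rw [if_pos hx, if_pos hy, if_pos (sup_mem_sups hx hy), if_pos (inf_mem_infs hx hy)]
        exact h x y
      · rw [if_neg hy, mul_zero]
        exact mul_nonneg (hc'0 _) (hd'0 _)
    · rw [if_neg hx, zero_mul]
      exact mul_nonneg (hc'0 _) (hd'0 _)
  have key := four_functions_graded_univ κ hκ a' b' c' d' ha'0 hb'0 hc'0 hd'0 h' e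
  -- identify the two sides
  have eL : ∑ p ∈ (univ : Finset (α × α)).filter (fun p => κ p.1 + κ p.2 = e), a' p.1 * b' p.2
      = ∑ p ∈ (s ×ˢ t).filter (fun p => κ p.1 + κ p.2 = e), a p.1 * b p.2 := by
    have h1 : ∑ p ∈ (s ×ˢ t).filter (fun p => κ p.1 + κ p.2 = e), a p.1 * b p.2
        = ∑ p ∈ (s ×ˢ t).filter (fun p => κ p.1 + κ p.2 = e), a' p.1 * b' p.2 := by
      refine Finset.sum_congr rfl fun p hp => ?_
      rw [mem_filter, mem_product] at hp
      simp only [ha', hb', if_pos hp.1.1, if_pos hp.1.2]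
    rw [h1]
    symm
    refine Finset.sum_subset (Finset.filter_subset_filter _ (subset_univ _)) fun p hp hps => ?_
    rw [mem_filter] at hp hps
    have hst : ¬ (p.1 ∈ s ∧ p.2 ∈ t) := fun hst => hps ⟨mem_product.2 hst, hp.2⟩
    simp only [ha', hb']
    by_cases h1 : p.1 ∈ s
    · have h2 : p.2 ∉ t := fun h2 => hst ⟨h1, h2⟩
      rw [if_neg h2, mul_zero]
    · rw [if_neg h1, zero_mul]
  have eR : ∑ p ∈ (univ : Finset (α × α)).filter (fun p => κ p.1 + κ p.2 = e), c' p.1 * d' p.2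
      = ∑ p ∈ ((s ⊻ t) ×ˢ (s ⊼ t)).filter (fun p => κ p.1 + κ p.2 = e), c p.1 * d p.2 := by
    have h1 : ∑ p ∈ ((s ⊻ t) ×ˢ (s ⊼ t)).filter (fun p => κ p.1 + κ p.2 = e), c p.1 * d p.2
        = ∑ p ∈ ((s ⊻ t) ×ˢ (s ⊼ t)).filter (fun p => κ p.1 + κ p.2 = e), c' p.1 * d' p.2 := by
      refine Finset.sum_congr rfl fun p hp => ?_
      rw [mem_filter, mem_product] at hp
      simp only [hc', hd', if_pos hp.1.1, if_pos hp.1.2]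
    rw [h1]
    symm
    refine Finset.sum_subset (Finset.filter_subset_filter _ (subset_univ _)) fun p hp hps => ?_
    rw [mem_filter] at hp hps
    have hst : ¬ (p.1 ∈ s ⊻ t ∧ p.2 ∈ s ⊼ t) := fun hst => hps ⟨mem_product.2 hst, hp.2⟩
    simp only [hc', hd']
    by_cases h1 : p.1 ∈ s ⊻ t
    · have h2 : p.2 ∉ s ⊼ t := fun h2 => hst ⟨h1, h2⟩
      rw [if_neg h2, mul_zero]
    · rw [if_neg h1, zero_mul]
  rw [eL, eR] at key
  exact key

/-- **Graded FKG / Chebyshev on any finite distributive lattice** (a consequence of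
[cite: ChanPak2023, Thm 6.1] via `fkg_fibre_real`, derived in this file): for a modular grading `κ`,
a log-supermodular weight `μ ≥ 0` and monotone real `f g`, every degree class satisfies
`∑_{κ x + κ y = e} μ x μ y f x g y ≤ ∑_{κ x + κ y = e} μ x μ y f x g x`.  On a product of finite chains
with `κ` the rank (or any modular statistic) this is the coefficientwise nonnegativity of
`Z² Cov(f, g)` as a polynomial in `q^{κ}`. -/
theorem fkg_graded_real (κ : α → M) (hκ : ∀ x y, κ x + κ y = κ (x ⊔ y) + κ (x ⊓ y))
    (μ f g : α → ℝ) (hμ₀ : 0 ≤ μ) (hf : Monotone f) (hg : Monotone g)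
    (hμ : ∀ x y, μ x * μ y ≤ μ (x ⊓ y) * μ (x ⊔ y)) (e : M) :
    ∑ p ∈ (univ : Finset (α × α)).filter (fun p => κ p.1 + κ p.2 = e),
        μ p.1 * μ p.2 * (f p.1 * g p.2)
      ≤ ∑ p ∈ (univ : Finset (α × α)).filter (fun p => κ p.1 + κ p.2 = e),
        μ p.1 * μ p.2 * (f p.1 * g p.1) := by
  rw [sum_degree_eq_sum_fibres κ hκ _ e, sum_degree_eq_sum_fibres κ hκ _ e]
  refine Finset.sum_le_sum fun u _ => Finset.sum_le_sum fun v _ => ?_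
  split_ifs
  · exact fkg_fibre_real μ f g hμ₀ hf hg hμ u v
  · exact le_rfl

end Graded

end Literature.Combinatorics.SetFamily
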